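import Summits.ResolutionOfSingularities.ResolutionOfSingularities.Theorems.FrobeniusClosingPatchingRelPerfectDepthSepPeelStep
import Summits.ResolutionOfSingularities.ResolutionOfSingularities.Theorems.FrobeniusClosingPatchingRelPerfectDepthMixedTargetsJR
import Literature.AlgebraicGeometry.Resolution.BlowupsProduct
import HarnessLib

/-!
# Crux `PatchingRelPerfect` (stmt-ResolutionOfSingularities-16161), chain W5.2 — F7(α) = F5c, target `WeightTwoBoundaryJRnr₃`
# (TargetsF5c v1.0, res-L1-w52-plan-1 STEER 4 (3)): PHASE-B^nr — PEELING A MULTIPLE HOST COMPONENT is a step of `IsWeightedSeqJR 2`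

[OURS · L1 W5.2 · rung tool] Replaces the role of NO printed item; NOT a statement of the manuscript under review; fact-free,
format-free (explicit hypotheses; the owner res-D-pv-052's non-reduced transport state delivers them at the END of the CJS phase).
AI-written (AI review is weaker than expert review).

THE PEEL^nr (plan-1 STEER 4 (3), hand proof «END: X_n regular, transversal to B_n ⇒ PEEL every component with e_k ≥ 2»).  At a state
`(𝔟', D', ℬ', 𝒟')` of a weight-`≤ 2` sequence with boundary and CARRIED (non-reduced, factorised) host, let `S` be a host component of
multiplicity `e ≥ 2`: `D' = S^e · M` with an `S`-free cofactor (`¬ M ≤ S`), `S` a member (with connected support) of an snc family `𝓔`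
that contains every boundary member, `S` itself not a boundary member, and NO N-charged member meeting `V(S)`.  Then blowing up `S`
— the identity of `E'` — is a legal `IsWeightedSeqJR.cons` with `ν = μ = 2` and host order `m = e`:
`𝔟' ≤ D' ≤ S^e ≤ S^2`; `2 ≤ e + w`; snc / uniform incidence of both exponent lists with `S` (p521900); the JOINT clause is VACUOUS
(`ν = μ`, and no N-charged member passes through a point of `V(S)`); the max-weight clause is vacuous (`ν = μ`); the transported host
is `colon D' (S^e) = M` (Cartier cancellation), which has no boundary component (`¬ D' ≤ B ⇒ ¬ M ≤ B`, and `st B = B` along the identity)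
and is not `≤ S`.  New state: `(colon 𝔟' (S^2), M, ℬ'ˢᵗ ++ [(S, e + w_ℬ − 2)], 𝒟'ˢᵗ ++ [(S, w_𝒟 + 0)])`.

* §1 `controlledTransform_id_pow` (`controlledTransform (𝟙 X) S 𝔟 m = colon 𝔟 (S ^ m)`), `colon_pow_mul_of_isEffectiveCartier`
  (`(S^e · M : S^e) = M`);
* §2 **`isWeightedSeqJR_peel`** — the step.
(The loop over all multiple components and the `EndStateJR` assembly follow in the companion module.)

## References
* J. Kollár, *Lectures on Resolution of Singularities* (2007), (3.111) Step 3. [Kollar2007]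
* U. Görtz, T. Wedhorn, *Algebraic Geometry I* (2020), (13.19) p. 413. [GortzWedhorn2020]
* V. Cossart, U. Jannsen, S. Saito, LNM 2270 (2020), Thm. 1.4 (the CJS phase preceding the peels; not used here). [CossartJannsenSaito2020]
-/

-- `Summit.<Summit>.<Sub>.Theorems` with `Sub = Summit` (single-conjunct summit, D-0017)
set_option linter.dupNamespace false

noncomputable section

open CategoryTheory AlgebraicGeometry TopologicalSpace IsLocalRing
open Literature.AlgebraicGeometry.Resolution

namespace Summit.ResolutionOfSingularities.ResolutionOfSingularities.Theorems

universe u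

namespace DepthSep

open DepthTargets

variable {E' E : Scheme.{u}}

/-! ## §1 Transforms along the identity with weight `m` -/

/-- Along the identity, the controlled transform of weight `m` is the colon ideal `(𝔟 : S^m)`. [folklore] -/
theorem controlledTransform_id_pow (S 𝔟 : E'.IdealSheafData) (m : ℕ) :
    controlledTransform (𝟙 E') S 𝔟 m = colon 𝔟 (S ^ m) := by
  rw [controlledTransform, Scheme.IdealSheafData.comap_id, Scheme.IdealSheafData.comap_id]

/-- **`(S^e · M : S^e) = M`** for an effective Cartier divisor `S`. [folklore] -/
theorem colon_pow_mul_of_isEffectiveCartier [IsLocallyNoetherian E'] {S : E'.IdealSheafData} (hS : IsEffectiveCartier S)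
    (e : ℕ) (M : E'.IdealSheafData) : colon (S ^ e * M) (S ^ e) = M := by
  refine (hS.pow e).eq_of_mul_eq_mul ?_
  exact pow_mul_colon_eq_of_le (L := S ^ e * M) hS (μ := e) (fun U => Ideal.mul_le_right)

/-- `S^e ≤ S^2` for `2 ≤ e`. [folklore] -/
theorem pow_le_sq {S : E'.IdealSheafData} {e : ℕ} (he : 2 ≤ e) : S ^ e ≤ S ^ 2 := by
  obtain ⟨k, rfl⟩ := Nat.exists_eq_add_of_le he
  rw [pow_add]
  exact fun U => Ideal.mul_le_right

/-! ## §2 The peel of a multiple host component is a weight-two step -/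

/-- **PEEL^nr: blowing up a host component of multiplicity `e ≥ 2` (the identity of `E'`) is a legal `IsWeightedSeqJR 2` step with
`ν = 2`, `m = e`** — see the module docstring for the clause-by-clause account.  Format-free: the hypotheses are what a non-reduced
CJS transport state knows at its END (host factorised over pairwise disjoint regular components transversal to the born boundary).
[cite: Kollar2007, (3.111) Step 3] [cite: GortzWedhorn2020, (13.19) p. 413] -/
theorem isWeightedSeqJR_peel [IsLocallyNoetherian E'] {ρ : E' ⟶ E} {𝔟₀ D₀ : E.IdealSheafData}
    {ℬ₀ 𝒟₀ : List (E.IdealSheafData × ℕ)} {𝔟' D' : E'.IdealSheafData} {ℬ' 𝒟' : List (E'.IdealSheafData × ℕ)}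
    {𝓔 : List E'.IdealSheafData} (h𝓔 : HasSNC 𝓔) {S M : E'.IdealSheafData} (hS : S ∈ 𝓔)
    (hSc : _root_.IsPreconnected (S.support : Set E')) {e : ℕ} (he : 2 ≤ e) (hD : D' = S ^ e * M) (hMS : ¬ M ≤ S)
    (h𝔟 : 𝔟' ≤ D') (hℬ : ∀ B ∈ boundaryOf ℬ', B ∈ 𝓔) (h𝒟 : ∀ B ∈ boundaryOf 𝒟', B ∈ 𝓔) (hSℬ : S ∉ boundaryOf ℬ')
    (hfree : ∀ p ∈ ℬ', ¬ D' ≤ p.1)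
    (hN : ∀ p ∈ 𝒟', 0 < p.2 → Disjoint (p.1.support : Set E') S.support)
    (hseq : IsWeightedSeqJR 2 ρ 𝔟₀ D₀ ℬ₀ 𝒟₀ 𝔟' D' ℬ' 𝒟') :
    IsWeightedSeqJR 2 (𝟙 E' ≫ ρ) 𝔟₀ D₀ ℬ₀ 𝒟₀ (colon 𝔟' (S ^ 2)) M
      (ℬ'.map (fun p => (strictTransformIdeal (𝟙 E') S p.1, p.2)) ++
        [(S.comap (𝟙 E'), e + weightOf ℬ' (divisorsOver ℬ' S S.support) - 2)])
      (𝒟'.map (fun p => (strictTransformIdeal (𝟙 E') S p.1, p.2)) ++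
        [(S.comap (𝟙 E'), weightOf 𝒟' (divisorsOver 𝒟' S S.support) + (2 - 2))]) := by
  have hES : HasSNCWith 𝓔 S := h𝓔.hasSNCWith_of_mem hS
  have hScart : IsEffectiveCartier S := hES.isEffectiveCartier_of_mem hS
  -- the transported host
  have hhost : controlledTransform (𝟙 E') S D' e = M := by
    rw [controlledTransform_id_pow, hD, colon_pow_mul_of_isEffectiveCartier hScart]
  have hDS : D' ≤ S ^ e := by rw [hD]; exact fun U => Ideal.mul_le_right
  have hDM : D' ≤ M := by rw [hD]; exact fun U => Ideal.mul_le_left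
  -- JOINT is vacuous: `ν = μ`, and no N-charged member meets `V(S)`
  have hjoint : ∀ z : E', z ∈ S.support → (2 < 2 ∨ ∃ p ∈ 𝒟', 0 < p.2 ∧ z ∈ p.1.support) →
      JointStepAtJR D' S ℬ' 𝒟' z := by
    rintro z hz (h | ⟨p, hp, hp0, hzp⟩)
    · exact absurd h (lt_irrefl 2)
    · exact absurd hz (Set.disjoint_left.mp (hN p hp hp0) hzp)
  have h := IsWeightedSeqJR.cons (μ := 2) (𝟙 E') ρ 𝔟₀ D₀ ℬ₀ 𝒟₀ 𝔟' D' ℬ' 𝒟' S 2 e hseq hES.isRegular_subscheme hSc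
    (by norm_num) le_rfl (h𝔟.trans (hDS.trans (pow_le_sq he))) hDS (le_add_right he)
    (hasSNCWith_of_subset_of_mem h𝓔 hℬ hS)
    (uniformPieces_single_of_hasSNC (h𝓔.of_subset fun D hD' =>
      (List.mem_cons.mp hD').elim (fun h => h ▸ hS) (hℬ D)))
    (uniformPieces_single_of_hasSNC (h𝓔.of_subset fun D hD' =>
      (List.mem_cons.mp hD').elim (fun h => h ▸ hS) (h𝒟 D)))
    hjoint (fun h => absurd h (lt_irrefl 2)) (isBlowup_id_of_mem h𝓔 hS)
    (fun p hp hle => by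
      -- no boundary component: `st B = B` (as `B ≠ S`), and `M ≤ B` would give `D' ≤ B`
      rw [hhost] at hle
      have hB𝓔 : p.1 ∈ 𝓔 := hℬ p.1 (fst_mem_boundaryOf hp)
      have hBS : p.1 ≠ S := fun h => hSℬ (h ▸ fst_mem_boundaryOf hp)
      rw [strictTransformIdeal_id_of_ne h𝓔 hS hB𝓔 hBS] at hle
      exact hfree p hp (hDM.trans hle))
    (fun hle => by
      rw [hhost, Scheme.IdealSheafData.comap_id] at hle
      exact hMS hle)
  rwa [hhost, controlledTransform_id_pow] at h

end DepthSep

end Summit.ResolutionOfSingularities.ResolutionOfSingularities.Theorems
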